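import Summits.Ventures.HodgeRepro.Statements
import Summits.Ventures.HodgeRepro.BallTopology
import Summits.Ventures.HodgeRepro.BallChainRule
import Summits.Ventures.HodgeRepro.BallCore

/-!
# Statement (c): the Hecke-translate wedge on the complex `2`-ball — proof (seat p3)

`HeckeTranslateWedge` (Statements.lean §C): for every dense subgroup `Δ ≤ U(2,1)` and all continuous
cotangent fields `F, G : 𝔹² → ℂ²` that are not identically zero, some translate `γ^*F`, `γ ∈ Δ`, has a
non-zero wedge with `G` at some point.

Proof: the algebraic core `BallCore.exists_wedge_ne_zero` (seat p5: some `γ₀ ∈ U(2,1)` and `z` already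
have a non-zero wedge — transitivity of `U(2,1)` on the ball, the chain rule for the Jacobian, the isotropy
at the origin and the `2×2` wedge algebra) and the continuity/density layer
`BallModel.exists_mem_wedge_ne_of_dense` (seat typer-2: the wedge is continuous in `γ` at the fixed
point `z`, so the non-vanishing locus is open and meets the dense `Δ`).  An independent self-contained
derivation of the same statement is `HeckeWedgeP3Core.lean` / `HeckeWedgeP3Shell.lean`.

Nothing here says anything about the status of the Hodge conjecture for CM abelian varieties, which is
NOT proved.
-/

set_option autoImplicit false

namespace Summit.Ventures.HodgeRepro

/-- **(c) The Hecke-translate wedge** — `HeckeTranslateWedge` holds. -/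
theorem heckeTranslateWedge : HeckeTranslateWedge := by
  intro Δ hΔ F G hF hG hF0 hG0
  obtain ⟨γ₀, z, h₀⟩ :=
    BallCore.exists_wedge_ne_zero F G (Function.ne_iff.1 hF0) (Function.ne_iff.1 hG0)
  obtain ⟨γ, hγΔ, hγ⟩ := BallModel.exists_mem_wedge_ne_of_dense hΔ hF hG h₀
  exact ⟨γ, hγΔ, z, hγ⟩

end Summit.Ventures.HodgeRepro
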